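/-
Copyright: the b2b-balaban T⁴-continuum CRUX team, row NE7b leaf lineage `t4-ne7b-formalise-leaf-02` (gen 135). Project licence.
-/
import Summits.QuantumFields.BalabanUV.T4Continuum.Spine.NE7b.OneStepAveragePeriodicity
import Literature.MathematicalPhysics.QuantumFieldTheory.Balaban1983to89.B7Eq125RightInverse

/-!
# PRINT's MAIN TERM (125) UNFOLDED IS THE AVERAGE-TERM SHAPE: `(Q₀A)(q, κ) = L^{−(d+1)}·Σ_{(r,t)} R(V₀(Γ_{q,q+r} ∪ [q+r, q+r+te_κ])) A(q + r + te_κ, κ)` on `ℤ^d`,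
# and, read at the block base points `q = L·y` of the two-scale torus through a torus field's periodic lift, EXACTLY the hypothesis `hY` of
# `…AverageTermsLinear` ∕ `…FullFormSineFloor` with `ω = L^{−(d+1)}` and transports `w_{j,(r,t)} = V₀(Γ_{L·y, L·y+r} ∪ [L·y+r, L·y+r+te_κ]) ∈ U1`
# (row NE7b, node U5c; residual (R2′) family (2), letter (ℓ1); E-side key reading — the average family of the (h2) slot is INHABITED by [B7] (125))

Cell `pub-balaban`, sub-cell `t4`, spine estimate NE7b (`T4WeightBudget.RelWeightBound`; the cell's OWN estimate — NOT PRINTED in [Bałaban 1983–89],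
NOT PROVED).  Crux-route work under `Spine/NE7b/` by a row leaf (`t4-ne7b-formalise-leaf-02`, E-side ∕ key-readings ∕ lattice-geometry lineage, gen 135)
under FREEZE (0)'s crux-prover clause; a [folklore] identity BY NAME over Literature modules with hub oleans; NOTHING of Bałaban's estimates is asserted; no
`def` (the transports are an `∃`-witness, the lift of a torus field is the lambda `fun x ν => B (tcls (LM) x) ν`); zero `sorry`; no `T4Continuum/Support` leaf.
Imports: this lineage's `…OneStepAveragePeriodicity` (`tcls_qb`; through it `B7Prop3GeneralLinear.Q0cov`, `T4TermwiseTorus.tcls`) and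
`Literature.….B7Eq125RightInverse` (NE9 owner lineage: `tsum_seg` — (58) along a straight segment; through it `B8Ineq132.conjR_sum`).

WHY.  `…AverageTermsLinear` (ATL) abstracts the average family of the (h2) slot's full form as `T_j B = ω·Σ_{(r,t)} R(w_{j,(r,t)}) B(ιA j (r,t))` with the
weight `ω` and the transports `w` as PARAMETERS, and `…FullFormSineFloor` (FFSF) displays the average functional through
`hY : Y j B = ‖ω • Σ_{(r,t)} conjR (w j (r,t)) (B (ιA j (r,t)).1 (ιA j (r,t)).2)‖`.  THIS FILE shows that print's own main term has that shape, by proof: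
[B7] (125) «(Q₀A)_c = (Q_{V₀}A)_c = Σ_{x∈B(c₋)} L^{−(d+1)}(R_{0,c₋}A)([x, x′])» (`B7Prop3GeneralLinear.Q0cov`: the tree contour `Γ_{c₋,x}` then the straight
segment `[x, x′]`, (58) «the product over b replaced by the sum») unfolds, by `tsum_seg` and (57) `R(X)R(Y) = R(XY)`, into ONE weighted sum over the `L^d·L`
positions `(r, t)` of rotated bond variables, each rotated by the background transport ALONG THE WHOLE PATH from `c₋` to the bond's starting point.  Read at the
base point `c₋ = L·y` of a coarse torus bond `(y, κ)` on the periodic lift of a torus field `B`, the fine bonds are TAI's `ιA (y,κ) (r,t) = (L·y + r + te_κ, κ)`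
(`tcls_qb`), so ATL's `hY` ∕ `hw′` are INHABITED with `ω = L^{−(d+1)}`, `w_{j,(r,t)} := V₀(Γ_{L·y,L·y+r} ∪ [L·y+r, L·y+r+te_κ])` (`hol_mem`: in `U1` when `V₀` is).
Which operator the row's (A3) finally names `Q₁(V)` (this `Q₀(V₀)`, the full linear part `L(Q(V₀)·)` of (122)∕(124), or `Support/CovariantBlockAveraging.Qcov`)
and the normalisation (`n^{(d−2)∕2}` inside or outside the square; Q-leaf05-g157-1) remain the OWNER's — this file prices the first candidate at zero
bookkeeping cost.

WHAT IS PROVED ([folklore]):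
* §1 **`Q0cov_eq_weighted_sum`** (`ℤ^d`, any `V₀`, `A`, `L`): `Q0cov L V₀ A q κ = (L^{d+1})⁻¹ • Σ_{(r,t) : (Fin d → Fin L) × Fin L}
  conjR (hol V₀ q (treeWord (boxVec L r) ++ seg κ t)) (A (q + boxVec L r + t•e_κ) κ)` (`tsum_seg`, `conjR_sum`, `conjR_mul_left`, `hol_append`, `disp_treeWord`).
* §2 **`tcls_qb_add_boxVec_add`** — the torus class of `L·y + r + te_κ` is TAI's site `(y_i·L + r_i)_i + t·δ_κ`; **`exists_printed_transports`** — for base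
  points `qb` (`hqb : qb y i = L·y_i`), TAI's incidence `ιA` (`hιA`) and `V₀ ∈ U1` pointwise: `∃ w, (∀ j rt, w j rt ∈ U1) ∧ ∀ j B,
  Q0cov L V₀ (fun x ν => B (tcls (LM) x) ν) (qb j.1) j.2 = (L^{d+1})⁻¹ • Σ_{rt} conjR (w j rt) (B (ιA j rt).1 (ιA j rt).2)`.
* §3 **`exists_printed_avgFunctional`** — the same in ATL's `hY` currency: `… ∧ ∀ j B, ‖Q0cov L V₀ (lift B) (qb j.1) j.2‖ = ‖(L^{d+1})⁻¹ • Σ_{rt} conjR (w j rt) (B …)‖`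
  — FFSF's `(ω, w′, hw′, Y, hY)` binders inhabited by (125) with `Y j B := ‖(Q₀(V₀)(lift B))(L·j.1, j.2)‖`.
* §4 toy: `d = 1`, `L = 2`, `M = 3`, `V₀ ≡ 1` — the hypotheses `hqb`, `hιA` fed by `rfl` (elaboration only).

NOT HERE (honest): the (A3) decision itself; the remainder `L(Q(V₀)·) − L·Q₀` of (124)∕(126) (an `O(L²α₀)` perturbation — `B7Prop3GeneralLinear`'s sequel, not a
shape statement); `k > 1`; any inequality of Bałaban's.  BY-NAME EFFECT ON THE WALL: NONE (the (h2) slot's average family at `k = 1` is inhabited by a printed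
object; the wall is (R2)).  NE7b NOT PRINTED ∕ NOT PROVED; spine PROVED 0∕9; rung (B)+1 on ONE finite T⁴ — NOT infinite volume, NOT the mass gap, NOT Clay.
HONEST DEPENDENCY: continuum YM on T⁴ ⇐ BetaPertH ∧ nine spine estimates (0/9 proved); BetaPertH ⇐ (D1) ∧ (D4) ∧ CAP+tail; G-an2-4 gates asym, D1 and NE2/3/4.
-/

set_option autoImplicit false

noncomputable section

open Finset
open Literature.MathematicalPhysics.QuantumFieldTheory.Balaban1983to89.B7Prop1Explicit (Site Letter e seg hol disp treeWord boxVec U1 hol_mem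
  hol_append disp_treeWord seg_natCast)
open Literature.MathematicalPhysics.QuantumFieldTheory.Balaban1983to89.B7Eq78Linearization (conjR)
open Literature.MathematicalPhysics.QuantumFieldTheory.Balaban1983to89.B7Prop3GeneralRotated (tsum conjR_mul_left)
open Literature.MathematicalPhysics.QuantumFieldTheory.Balaban1983to89.B7Prop3GeneralLinear (Q0cov)
open Literature.MathematicalPhysics.QuantumFieldTheory.Balaban1983to89.B8Ineq132 (conjR_sum)
open Literature.MathematicalPhysics.QuantumFieldTheory.Balaban1983to89.B7Eq125RightInverse (tsum_seg)
open Literature.MathematicalPhysics.QuantumFieldTheory.Balaban1983to89.T4TermwiseTorus (tcls tcls_apply)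
open Summit.QuantumFields.BalabanUV.T4Continuum.NE7b.OneStepAveragePeriodicity (tcls_qb)

namespace Summit.QuantumFields.BalabanUV.T4Continuum.NE7b.AverageTermsPrinted

variable {d : ℕ}
variable {𝔸 : Type*} [NormedRing 𝔸] [NormedAlgebra ℂ 𝔸] [NormOneClass 𝔸] [CompleteSpace 𝔸]

/-! ## §1 (125) unfolded on `ℤ^d`: one weighted sum of rotated bond variables over the `L^d·L` positions -/

omit [NormOneClass 𝔸] [CompleteSpace 𝔸] in
/-- **(125) UNFOLDED**: `(Q₀A)(q, κ) = L^{−(d+1)}·Σ_{(r,t)} R(V₀(Γ_{q,q+r} ∪ [q+r, q+r+te_κ])) A(q + r + te_κ, κ)` — the tree contour followed by the first `t`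
bonds of the segment is the path along which the bond variable at position `(r, t)` is rotated ((58) + (57) `R(X)R(Y) = R(XY)`). [folklore] -/
theorem Q0cov_eq_weighted_sum (L : ℕ) (V₀ : Site d → Fin d → 𝔸ˣ) (A : Site d → Fin d → 𝔸) (q : Site d) (κ : Fin d) :
    Q0cov L V₀ A q κ = (((L : ℝ) ^ (d + 1))⁻¹) • ∑ rt : (Fin d → Fin L) × Fin L,
      conjR (hol V₀ q (treeWord (boxVec L rt.1) ++ seg κ ((rt.2 : ℕ) : ℤ))) (A (q + boxVec L rt.1 + ((rt.2 : ℕ) : ℤ) • e κ) κ) := by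
  rw [Q0cov, Fintype.sum_prod_type, Finset.smul_sum]
  refine Finset.sum_congr rfl fun r _ => ?_
  congr 1
  rw [tsum_seg V₀ A (q + boxVec L r) κ L, conjR_sum, Finset.sum_range (fun j => conjR (hol V₀ q (treeWord (boxVec L r)))
    (conjR (hol V₀ (q + boxVec L r) (seg κ (j : ℤ))) (A (q + boxVec L r + (j : ℤ) • e κ) κ)))]
  refine Finset.sum_congr rfl fun t _ => ?_
  rw [← conjR_mul_left, hol_append, disp_treeWord]

/-! ## §2 Read at the block base points of the two-scale torus on a periodic lift: TAI's bonds, transports in `U1` -/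

/-- The torus class of the fine site `L·y + r + te_κ` is TAI's `(y_i·L + r_i)_i + t·δ_κ` on `(ℤ∕LM)^d`. [folklore] -/
theorem tcls_qb_add_boxVec_add (L M : ℕ) (qb : (Fin d → ZMod M) → Site d) (hqb : ∀ y i, qb y i = (L : ℤ) * (((y i).val : ℕ) : ℤ))
    (y : Fin d → ZMod M) (κ : Fin d) (r : Fin d → Fin L) (t : Fin L) :
    tcls (L * M) (qb y + boxVec L r + ((t : ℕ) : ℤ) • e κ)
      = (fun i => ((((y i).val * L + (r i : ℕ) : ℕ)) : ZMod (L * M))) + Pi.single κ (((t : ℕ) : ℕ) : ZMod (L * M)) := by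
  funext i
  simp only [tcls_apply, Pi.add_apply, hqb, boxVec, Pi.smul_apply, e, Pi.single_apply, smul_eq_mul, mul_ite, mul_one, mul_zero]
  push_cast
  split_ifs <;> ring

omit [CompleteSpace 𝔸] in
/-- **THE PRINTED TRANSPORTS**: for block base points `qb y = L·y`, TAI's incidence `ιA` and a background `V₀` in the unit-ball class there are transports
`w_{j,(r,t)} ∈ U1` (namely `V₀(Γ_{L·y,L·y+r} ∪ [L·y+r, L·y+r+te_κ])`) with, for EVERY torus field `B` read through its periodic lift,
`(Q₀(V₀)(lift B))(L·y, κ) = L^{−(d+1)} • Σ_{(r,t)} R(w_{(y,κ),(r,t)}) B(ιA (y,κ) (r,t))` — ATL's term shape with `ω = L^{−(d+1)}`. [folklore] -/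
theorem exists_printed_transports (L M : ℕ) (qb : (Fin d → ZMod M) → Site d) (hqb : ∀ y i, qb y i = (L : ℤ) * (((y i).val : ℕ) : ℤ))
    (ιA : (Fin d → ZMod M) × Fin d → (Fin d → Fin L) × Fin L → (Fin d → ZMod (L * M)) × Fin d)
    (hιA : ∀ y κ r t, ιA (y, κ) (r, t) =
      ((fun i => (((y i).val * L + (r i : ℕ) : ℕ) : ZMod (L * M))) + Pi.single κ ((t : ℕ) : ZMod (L * M)), κ))
    (V₀ : Site d → Fin d → 𝔸ˣ) (hV : ∀ x κ, V₀ x κ ∈ U1 𝔸) :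
    ∃ w : (Fin d → ZMod M) × Fin d → (Fin d → Fin L) × Fin L → 𝔸ˣ, (∀ j rt, w j rt ∈ U1 𝔸) ∧
      ∀ (j : (Fin d → ZMod M) × Fin d) (B : (Fin d → ZMod (L * M)) → Fin d → 𝔸),
        Q0cov L V₀ (fun x ν => B (tcls (L * M) x) ν) (qb j.1) j.2
          = (((L : ℝ) ^ (d + 1))⁻¹) • ∑ rt, conjR (w j rt) (B (ιA j rt).1 (ιA j rt).2) := by
  refine ⟨fun j rt => hol V₀ (qb j.1) (treeWord (boxVec L rt.1) ++ seg j.2 ((rt.2 : ℕ) : ℤ)), fun j rt => hol_mem hV _ _, ?_⟩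
  rintro ⟨y, κ⟩ B
  rw [Q0cov_eq_weighted_sum]
  congr 1
  refine Finset.sum_congr rfl fun rt _ => ?_
  obtain ⟨r, t⟩ := rt
  rw [hιA, tcls_qb_add_boxVec_add L M qb hqb y κ r t]

/-! ## §3 … in ATL's `hY` currency: the average functional of the (h2) slot INHABITED by (125) -/

omit [CompleteSpace 𝔸] in
/-- **ATL's ∕ FFSF's `(ω, w′, hw′, Y, hY)` INHABITED BY PRINT's (125)**: with `Y j B := ‖(Q₀(V₀)(lift B))(L·j.1, j.2)‖` there are `w′ ∈ U1` with
`Y j B = ‖L^{−(d+1)} • Σ_{(r,t)} conjR (w′ j (r,t)) (B (ιA j (r,t)).1 (ιA j (r,t)).2)‖` for all `j`, `B` — `…AverageTermsLinear.norm_sum_avgMaps_eq`'s `hY` and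
`…FullFormSineFloor.ims_floor_full_form`'s `hw′`∕`hY` character for character, `ω := (L^{d+1})⁻¹`. [folklore] -/
theorem exists_printed_avgFunctional (L M : ℕ) (qb : (Fin d → ZMod M) → Site d) (hqb : ∀ y i, qb y i = (L : ℤ) * (((y i).val : ℕ) : ℤ))
    (ιA : (Fin d → ZMod M) × Fin d → (Fin d → Fin L) × Fin L → (Fin d → ZMod (L * M)) × Fin d)
    (hιA : ∀ y κ r t, ιA (y, κ) (r, t) =
      ((fun i => (((y i).val * L + (r i : ℕ) : ℕ) : ZMod (L * M))) + Pi.single κ ((t : ℕ) : ZMod (L * M)), κ))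
    (V₀ : Site d → Fin d → 𝔸ˣ) (hV : ∀ x κ, V₀ x κ ∈ U1 𝔸) :
    ∃ w : (Fin d → ZMod M) × Fin d → (Fin d → Fin L) × Fin L → 𝔸ˣ, (∀ j rt, w j rt ∈ U1 𝔸) ∧
      ∀ (j : (Fin d → ZMod M) × Fin d) (B : (Fin d → ZMod (L * M)) → Fin d → 𝔸),
        ‖Q0cov L V₀ (fun x ν => B (tcls (L * M) x) ν) (qb j.1) j.2‖
          = ‖(((L : ℝ) ^ (d + 1))⁻¹) • ∑ rt, conjR (w j rt) (B (ιA j rt).1 (ιA j rt).2)‖ := by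
  obtain ⟨w, hw, h⟩ := exists_printed_transports L M qb hqb ιA hιA V₀ hV
  exact ⟨w, hw, fun j B => by rw [h j B]⟩

/-! ## §4 Toy: `d = 1`, `L = 2`, `M = 3`, flat background — the hypotheses are inhabited by the defining lambdas (elaboration only) -/

/-- Toy: on the two-scale `6`-cycle with `V₀ ≡ 1` the printed transports exist for the base points `qb y = 2·y` and TAI's lambda incidence, both fed by
`rfl` — junction by elaboration (no kernel arithmetic on `ZMod 6`). -/
example : True := by
  have := exists_printed_avgFunctional (𝔸 := 𝔸) (d := 1) 2 3 (fun y i => (2 : ℤ) * (((y i).val : ℕ) : ℤ)) (fun _ _ => rfl)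
    (fun (j : (Fin 1 → ZMod 3) × Fin 1) (rt : (Fin 1 → Fin 2) × Fin 2) =>
      ((fun i => (((j.1 i).val * 2 + (rt.1 i : ℕ) : ℕ) : ZMod (2 * 3))) + Pi.single j.2 ((rt.2 : ℕ) : ZMod (2 * 3)), j.2))
    (fun _ _ _ _ => rfl) (fun _ _ => 1) (fun _ _ => Subgroup.one_mem _)
  trivial

end Summit.QuantumFields.BalabanUV.T4Continuum.NE7b.AverageTermsPrinted

end
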